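/-
Origin: expansion seat `planner-pub-hodgecm-pv10-g3-0`, handover #5 2026-08-18T08:56:03Z (`HOME/pub-hodgecm-pv10-g3/lean/Pv10g3/GodementCompact.lean`, md5 ab24a65c, 488 lines);
landed by the gen-7 packager in gate run 27 as `HodgeCM/PerL34/GodementCompact.lean` (import ^import Pv10g3V\.→import HodgeCM.Vendored.H21. ×1; import ^import Pv10g3\.→import HodgeCM.PerL34. ×3).
-/
/-
Copyright (c) 2026. All rights reserved.
Released under Apache 2.0 license as described in the file LICENSE.
-/
import Summits.HodgeConjecture.HodgeCM.PerL34.MahlerCriterion_2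
import Summits.HodgeConjecture.HodgeCM.PerL34.HeightGalois
import Summits.HodgeConjecture.HodgeCM.PerL34.StabilizerDescent
import Literature.NumberTheory.Automorphic.AdelicVectorHeightBound
import Summits.HodgeConjecture.HodgeCM.Automorphic.AdelicUnitaryModel_2

/-!
# Compactness of `U(H)(L⁺)\U(H)(𝔸_{L⁺})` for an anisotropic hermitian form (Godement's criterion)

KERNEL proof of `HodgeCM.PrintFact_unitaryCompact` (the `[PRINT]` hypothesis of the adelic end state
in `HodgeCM.Automorphic.AdelicUnitaryModel`): for a CM field `L`, `H ∈ M_n(L)` and the CM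
conjugation `c`, if the hermitian form `⟪x, y⟫ = (c x)ᵀ H y` is **anisotropic** over `L`
(`⟪x, x⟫ = 0 ⇒ x = 0`), then the adelic quotient `U(H)(L⁺)\U(H)(𝔸_{L⁺})`
(`adelicUnitaryGroup L H ⧸ adelicUnitaryRat L H`) is compact.

The argument is the Mostow–Tamagawa / Godement proof of the compactness criterion
(Godement, Sém. Bourbaki 257, §§1–4; Borel, *Introduction aux groupes arithmétiques*, §8;
Platonov–Rapinchuk, Thm. 5.5 and §5.3), assembled from kernel-checked pieces:

1. **Mahler's criterion on `GL_n(𝔸_L)`** (`HodgeCM.PerL34.MahlerCriterion`, from the vendored Minkowski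
   reduction): a subset of `GL_n(𝔸_L)` on which `|det|_𝔸` is bounded and the heights `h(g ξ)`,
   `ξ ∈ Lⁿ ∖ 0`, are bounded away from `0` lies in `C · GL_n(L)` with `C` compact.
2. **Heights are bounded below on `U(H)(𝔸)`** (§3 below): for `g ∈ U(H)(𝔸)` and `ξ ∈ Lⁿ ∖ 0`,
   `q = ⟪ξ, ξ⟫ ∈ L×` (anisotropy), `|q|_𝔸 = 1` (product formula), and
   `q = ⟪g ξ, g ξ⟫ = (c (g ξ))ᵀ H_𝔸 (g ξ)`, so the **fundamental inequality**
   `|xᵀ y|_𝔸 ≤ h(x) h(y)` (§1: Cauchy–Schwarz at the infinite places, the ultrametric inequality at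
   the finite places) and the Galois invariance of heights `h(c x) = h(x)` (`HodgeCM.PerL34.HeightGalois`)
   give `1 ≤ h(g ξ) · H(H_𝔸ᵀ) · h(g ξ)`, whence a uniform floor.
3. **`|det g|_𝔸 = 1` on `U(H)(𝔸)`** (§4): `c(det g) · det H · det g = det H`, `det H ≠ 0`, and
   `|c a|_𝔸 = |a|_𝔸`.
4. **Descent from `GL_n` to the stabiliser** (`HodgeCM.PerL34.StabilizerDescent`, the abstract
   Mostow–Tamagawa lemma) for the right action `X · g = (c g)ᵀ X g` of `GL_n(𝔸_L)` on `M_n(𝔸_L)`,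
   whose stabiliser at `H_𝔸` is `U(H)(𝔸)`, with `Γ = GL_n(L)` and `D = M_n(L)` (closed and discrete
   in `M_n(𝔸_L)`, so it meets compact sets in finite sets): `U(H)(𝔸) ⊆ C' · (U(H)(𝔸) ∩ GL_n(L))`
   with `C' ⊆ U(H)(𝔸)` compact.
5. `U(H)(𝔸) ∩ GL_n(L) = U(H)(L⁺)` (entrywise injectivity of `L → 𝔸_L`), so the compact set `C'`
   surjects onto the quotient.

Main results (namespace `HodgeCM.PerL34.Godement`):

* `ideleNorm_le_vecHeight_mul_vecHeight` — the fundamental inequality `|xᵀ y|_𝔸 ≤ h(x) h(y)`.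
* `exists_vecHeight_floor` — the height floor on an anisotropic adelic unitary group.
* `ideleNorm_det_eq_one` — `|det g|_𝔸 = 1` on `U(H)(𝔸)`.
* `compactSpace_adelicUnitaryQuot` — compactness of `U(H)(L⁺)\U(H)(𝔸_{L⁺})`, `H` anisotropic.
* `HodgeCM.printFact_unitaryCompact_holds : HodgeCM.PrintFact_unitaryCompact` — the `[PRINT]`
  hypothesis of the adelic end state, now a theorem.
-/

noncomputable section

open scoped NNReal Matrix Pointwise MatrixGroups
open NumberField IsDedekindDomain

namespace HodgeCM.PerL34.Godement

open Literature.NumberTheory Literature.NumberTheory.Automorphic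
open Literature.AlgebraicGeometry.ShimuraVarieties
open HodgeCM.Adelic HodgeCM.PerL34.StabilizerDescent

/-! ## §1 The fundamental inequality `|xᵀ y|_𝔸 ≤ h(x) · h(y)` -/

section Fundamental

variable {K : Type} [Field K] [NumberField K] {ι : Type*} [Fintype ι]

/-- Ultrametric bound at a finite place: `|∑ᵢ xᵢ yᵢ|_v ≤ h_v(x) · h_v(y)`. -/
theorem nnnorm_dotProduct_snd_le (v : HeightOneSpectrum (𝓞 K)) (x y : ι → AdeleRing (𝓞 K) K) :
    ‖(x ⬝ᵥ y).2 v‖₊ ≤ vecFinHeight K v x * vecFinHeight K v y := by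
  have hsum : (x ⬝ᵥ y).2 v = ∑ i, (x i).2 v * (y i).2 v := by
    rw [dotProduct, ← AdelicGroupData.adeleEval_apply (K := K) v, map_sum]
    simp only [map_mul, AdelicGroupData.adeleEval_apply]
  rw [hsum]
  refine IsUltrametricDist.nnnorm_sum_le_of_forall_le fun i _ => ?_
  rw [nnnorm_mul]
  exact mul_le_mul' (nnnorm_snd_apply_le_vecFinHeight v x i) (nnnorm_snd_apply_le_vecFinHeight v y i)

/-- Cauchy–Schwarz at an infinite place: `|∑ᵢ xᵢ yᵢ|_w ≤ ‖x‖_w · ‖y‖_w`. -/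
theorem nnnorm_dotProduct_fst_le (w : InfinitePlace K) (x y : ι → AdeleRing (𝓞 K) K) :
    ‖(x ⬝ᵥ y).1 w‖₊ ≤ vecArchNorm K w x * vecArchNorm K w y := by
  have hsum : (x ⬝ᵥ y).1 w = ∑ i, (x i).1 w * (y i).1 w := by
    rw [dotProduct, ← AdeleRing.fstEval_apply w, map_sum]
    simp only [map_mul, AdeleRing.fstEval_apply]
  rw [hsum, vecArchNorm, vecArchNorm]
  calc ‖∑ i, (x i).1 w * (y i).1 w‖₊
      ≤ ∑ i, ‖(x i).1 w * (y i).1 w‖₊ := nnnorm_sum_le _ _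
    _ = ∑ i, ‖(x i).1 w‖₊ * ‖(y i).1 w‖₊ := Finset.sum_congr rfl fun i _ => nnnorm_mul _ _
    _ ≤ NNReal.sqrt (∑ i, ‖(x i).1 w‖₊ ^ 2) * NNReal.sqrt (∑ i, ‖(y i).1 w‖₊ ^ 2) :=
        NNReal.sum_mul_le_sqrt_mul_sqrt _ _ _

/-- **The fundamental inequality** (Liouville / product-formula inequality): if the scalar product
`xᵀ y = ∑ᵢ xᵢ yᵢ` of two adelic vectors with finite height data is an idele `a`, then
`|a|_𝔸 ≤ h(x) · h(y)` (Godement, Sém. Bourbaki 257, §1.1; Platonov–Rapinchuk §5.3). -/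
theorem ideleNorm_le_vecHeight_mul_vecHeight {x y : ι → AdeleRing (𝓞 K) K}
    (hx : IsHeightFinite K x) (hy : IsHeightFinite K y) (a : (AdeleRing (𝓞 K) K)ˣ)
    (ha : (a : AdeleRing (𝓞 K) K) = x ⬝ᵥ y) :
    IdeleClassGroup.ideleNorm K a ≤ vecHeight K x * vecHeight K y := by
  rw [Literature.NumberTheory.Automorphic.ideleNorm_apply, vecHeight, vecHeight, mul_mul_mul_comm, ← Finset.prod_mul_distrib,
    ← finprod_mul_distrib hx hy]
  refine mul_le_mul' (Finset.prod_le_prod' fun w _ => ?_) ?_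
  · rw [← mul_pow]
    refine pow_le_pow_left' ?_ _
    rw [ha]
    exact nnnorm_dotProduct_fst_le w x y
  · refine finprod_le_finprod' (hasFiniteMulSupport_nnnorm K a)
      ((hx.union hy).subset (Function.mulSupport_mul _ _)) fun v => ?_
    change ‖(a : AdeleRing (𝓞 K) K).2 v‖₊ ≤ vecFinHeight K v x * vecFinHeight K v y
    rw [ha]
    exact nnnorm_dotProduct_snd_le v x y

end Fundamental

/-! ## §2 Hermitian forms: invariance under the unitary group, base change to the adeles -/

section Hermitian

variable {R : Type*} [CommRing R] {m : Type*} [Fintype m] [DecidableEq m]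

/-- `⟪g u, g v⟫ = ⟪u, v⟫` for `g` in the unitary group of `⟪·, ·⟫_H`. -/
theorem hermForm_mulVec_mulVec {σ : R →+* R} {H : Matrix m m R} {g : GL m R}
    (hg : g ∈ unitaryGroup σ H) (u v : m → R) :
    hermForm σ H ((g : Matrix m m R) *ᵥ u) ((g : Matrix m m R) *ᵥ v) = hermForm σ H u v := by
  rw [mem_unitaryGroup_iff] at hg
  unfold hermForm
  have h1 : (σ ∘ ((g : Matrix m m R) *ᵥ u)) = ((g : Matrix m m R).map σ) *ᵥ (σ ∘ u) := by
    funext i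
    exact RingHom.map_mulVec σ _ u i
  rw [h1]
  calc ((g : Matrix m m R).map σ *ᵥ (σ ∘ u)) ⬝ᵥ (H *ᵥ ((g : Matrix m m R) *ᵥ v))
      = ((σ ∘ u) ᵥ* ((g : Matrix m m R).map σ)ᵀ) ⬝ᵥ (H *ᵥ ((g : Matrix m m R) *ᵥ v)) := by
        rw [Matrix.vecMul_transpose]
    _ = (σ ∘ u) ⬝ᵥ ((((g : Matrix m m R).map σ)ᵀ * H * (g : Matrix m m R)) *ᵥ v) := by
        rw [← Matrix.dotProduct_mulVec]
        simp only [Matrix.mulVec_mulVec, Matrix.mul_assoc]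
    _ = (σ ∘ u) ⬝ᵥ (H *ᵥ v) := by rw [hg]

end Hermitian

section CMField

variable (L : Type) [Field L] [NumberField L] [IsCMField L]
variable {n : Type} [Fintype n] [DecidableEq n]

local notation "𝔸L" => AdeleRing (𝓞 L) L

omit [DecidableEq n] in
/-- Base change of the hermitian form to the adeles on principal vectors:
`(⟪ξ, η⟫_H)_𝔸 = ⟪ξ_𝔸, η_𝔸⟫_{H_𝔸}` for the involution `c ⊗ id` of `𝔸_L`. -/
theorem algebraMap_hermForm (H : Matrix n n L) (ξ η : n → L) :
    algebraMap L 𝔸L (hermForm (conjRingHomK L) H ξ η) =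
      hermForm (adeleConj L) (H.map (algebraMap L 𝔸L)) (principalVec L ξ) (principalVec L η) := by
  unfold hermForm
  rw [RingHom.map_dotProduct]
  have h1 : (algebraMap L 𝔸L) ∘ (conjRingHomK L ∘ ξ) = adeleConj L ∘ principalVec L ξ := by
    funext i
    simp only [Function.comp_apply, principalVec, adeleConj_algebraMap]
  have h2 : (algebraMap L 𝔸L) ∘ (H *ᵥ η) = H.map (algebraMap L 𝔸L) *ᵥ principalVec L η := by
    funext i
    rw [Function.comp_apply, RingHom.map_mulVec]
    rfl
  rw [h1, h2]

/-! ## §3 Galois invariance: heights and idele norms under `c ⊗ id` -/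

omit [Fintype n] [DecidableEq n] in
/-- Coordinatewise conjugation is the Galois action of `c` on adelic vectors (definitional). -/
theorem adeleConj_comp_eq_smul (x : n → 𝔸L) :
    (adeleConj L ∘ x) = (IsCMField.complexConj L) • x := rfl

omit [DecidableEq n] in
/-- `h(c x) = h(x)` for adelic vectors. -/
theorem vecHeight_adeleConj (x : n → 𝔸L) : vecHeight L (adeleConj L ∘ x) = vecHeight L x := by
  rw [adeleConj_comp_eq_smul]
  exact HeightGalois.vecHeight_galSmul (IsCMField.complexConj L) x

omit [DecidableEq n] in
/-- Finite height data is preserved by `c ⊗ id`. -/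
theorem isHeightFinite_adeleConj {x : n → 𝔸L} (hx : IsHeightFinite L x) :
    IsHeightFinite L (adeleConj L ∘ x) := by
  rw [adeleConj_comp_eq_smul]
  exact (HeightGalois.isHeightFinite_galSmul_iff (IsCMField.complexConj L) x).mpr hx

/-- `c ⊗ id` on ideles is the Galois action of `c` on `𝔸_Lˣ`. -/
theorem unitsMap_adeleConj (d : (𝔸L)ˣ) :
    Units.map (adeleConj L : 𝔸L →* 𝔸L) d = (IsCMField.complexConj L) • d :=
  Units.ext rfl

/-- `|c a|_𝔸 = |a|_𝔸` for ideles `a`. -/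
theorem ideleNorm_unitsMap_adeleConj (d : (𝔸L)ˣ) :
    IdeleClassGroup.ideleNorm L (Units.map (adeleConj L : 𝔸L →* 𝔸L) d) =
      IdeleClassGroup.ideleNorm L d := by
  rw [unitsMap_adeleConj]
  apply NNReal.coe_injective
  rw [← NormOneCompactHolds.ideleNorm_eq_coe, ← NormOneCompactHolds.ideleNorm_eq_coe]
  exact NumberField.ideleNorm_galSmul (IsCMField.complexConj L) d

/-! ## §4 The height floor and `|det| = 1` on an anisotropic adelic unitary group -/

omit [DecidableEq n] in
/-- An anisotropic form has `det H ≠ 0`. -/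
theorem det_ne_zero_of_anisotropic [DecidableEq n] (H : Matrix n n L)
    (hanis : ∀ x : n → L, hermForm (conjRingHomK L) H x x = 0 → x = 0) : H.det ≠ 0 := by
  intro hdet
  obtain ⟨v, hv, hHv⟩ := Matrix.exists_mulVec_eq_zero_iff.mpr hdet
  refine hv (hanis v ?_)
  unfold hermForm
  rw [hHv, dotProduct_zero]

omit [IsCMField L] in
/-- For `g ∈ U(H)(𝔸)` and `ξ ∈ Lⁿ`, the vector `H_𝔸 (g ξ_𝔸)` is `ξ_𝔸 (H_𝔸 g)ᵀ`, a primitive vector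
under an element of `GL_n(𝔸_L)` when `det H ≠ 0`. -/
theorem mulVec_mulVec_principalVec_eq (H : Matrix n n L) (hdet : H.det ≠ 0)
    (g : GL n 𝔸L) (ξ : n → L) :
    H.map (algebraMap L 𝔸L) *ᵥ ((g : Matrix n n 𝔸L) *ᵥ principalVec L ξ) =
      principalVec L ξ ᵥ*
        ((Mahler.glTranspose (toAdeleGL L (Matrix.GeneralLinearGroup.mkOfDetNeZero H hdet) * g) :
          GL n 𝔸L) : Matrix n n 𝔸L) := by
  rw [Mahler.vecMul_glTranspose, Units.val_mul, ← Matrix.mulVec_mulVec]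
  rfl

/-- **The height floor on `U(H)(𝔸)`**: if `⟪·, ·⟫_H` is anisotropic, there is `c > 0` with
`c ≤ h(g ξ_𝔸)` for all `g ∈ U(H)(𝔸_{L⁺})` and all `ξ ∈ Lⁿ ∖ 0`
(Godement, Sém. Bourbaki 257, §4, Lemme 4; Platonov–Rapinchuk, proof of Thm. 5.5). -/
theorem exists_vecHeight_floor (H : Matrix n n L)
    (hanis : ∀ x : n → L, hermForm (conjRingHomK L) H x x = 0 → x = 0) :
    ∃ c : ℝ≥0, 0 < c ∧ ∀ g ∈ adelicUnitaryGroup L H, ∀ ξ : n → L, ξ ≠ 0 →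
      c ≤ vecHeight L ((g : Matrix n n 𝔸L) *ᵥ principalVec L ξ) := by
  have hdet : H.det ≠ 0 := det_ne_zero_of_anisotropic L H hanis
  set HA : Matrix n n 𝔸L := H.map (algebraMap L 𝔸L) with hHA
  set B : ℝ≥0 := matHeightBound L HAᵀ with hB
  have hM : (1 ⊔ B) ≠ 0 := ne_of_gt (lt_of_lt_of_le zero_lt_one le_sup_left)
  refine ⟨(1 ⊔ B)⁻¹, inv_pos.mpr (pos_of_ne_zero hM), fun g hg ξ hξ => ?_⟩
  -- notation
  set y : n → 𝔸L := (g : Matrix n n 𝔸L) *ᵥ principalVec L ξ with hy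
  -- `q = ⟪ξ, ξ⟫ ∈ L×`, `|q|_𝔸 = 1`
  set q : L := hermForm (conjRingHomK L) H ξ ξ with hq
  have hq0 : q ≠ 0 := fun h => hξ (hanis ξ h)
  set a : (𝔸L)ˣ := Units.map (algebraMap L 𝔸L : L →* 𝔸L) (Units.mk0 q hq0) with ha
  have ha1 : IdeleClassGroup.ideleNorm L a = 1 := ideleNorm_principal ⟨Units.mk0 q hq0, rfl⟩
  -- `q_𝔸 = (c y)ᵀ (H_𝔸 y)`
  have haval : (a : 𝔸L) = (adeleConj L ∘ y) ⬝ᵥ (HA *ᵥ y) := by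
    change algebraMap L 𝔸L q = _
    rw [hq, algebraMap_hermForm, ← hermForm_mulVec_mulVec hg]
    rfl
  -- finiteness of the height data
  have hyfin : IsHeightFinite L y := by
    rw [hy, ← Mahler.vecMul_glTranspose]
    exact isHeightFinite_principalVec_vecMul hξ _
  have hHyfin : IsHeightFinite L (HA *ᵥ y) := by
    rw [hy, hHA, mulVec_mulVec_principalVec_eq L H hdet g ξ]
    exact isHeightFinite_principalVec_vecMul hξ _
  -- the fundamental inequality: `1 ≤ h(c y) h(H_𝔸 y) ≤ h(y) · B · h(y)`
  have h1 : 1 ≤ vecHeight L y * ((1 ⊔ B) * vecHeight L y) := by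
    have hfi := ideleNorm_le_vecHeight_mul_vecHeight (isHeightFinite_adeleConj L hyfin) hHyfin a haval
    rw [ha1, vecHeight_adeleConj] at hfi
    refine hfi.trans (mul_le_mul_right ?_ _)
    have hHy : HA *ᵥ y = y ᵥ* HAᵀ := (Matrix.vecMul_transpose HA y).symm
    have hfin' : IsHeightFinite L (y ᵥ* HAᵀ) := hHy ▸ hHyfin
    rw [hHy]
    exact (vecHeight_vecMul_le hyfin hfin').trans (mul_le_mul_left le_sup_right _)
  -- conclude `(1 ⊔ B)⁻¹ ≤ h(y)`
  rcases le_or_gt 1 (vecHeight L y) with hge | hlt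
  · exact (inv_le_one_of_one_le₀ (le_sup_left : (1 : ℝ≥0) ≤ 1 ⊔ B)).trans hge
  · refine (NNReal.inv_le hM).mpr ?_
    calc (1 : ℝ≥0) ≤ vecHeight L y * ((1 ⊔ B) * vecHeight L y) := h1
      _ = (1 ⊔ B) * (vecHeight L y * vecHeight L y) := by ring
      _ ≤ (1 ⊔ B) * vecHeight L y :=
          mul_le_mul_right (mul_le_of_le_one_right zero_le hlt.le) _

/-- **`|det g|_𝔸 = 1` on `U(H)(𝔸)`** when `det H ≠ 0`: from `(c g)ᵀ H_𝔸 g = H_𝔸`,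
`c(det g) · det g = 1`, and `|c a|_𝔸 = |a|_𝔸`. -/
theorem ideleNorm_det_eq_one (H : Matrix n n L) (hdet : H.det ≠ 0) {g : GL n 𝔸L}
    (hg : g ∈ adelicUnitaryGroup L H) :
    IdeleClassGroup.ideleNorm L (Matrix.GeneralLinearGroup.det g) = 1 := by
  rw [mem_adelicUnitaryGroup_iff] at hg
  set f := algebraMap L 𝔸L with hf
  -- the determinant identity in `𝔸_L`
  have hdetA : adeleConj L (g : Matrix n n 𝔸L).det * (H.map f).det * (g : Matrix n n 𝔸L).det =
      (H.map f).det := by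
    have h := congrArg Matrix.det hg
    rw [Matrix.det_mul, Matrix.det_mul, Matrix.det_transpose] at h
    rw [RingHom.map_det]
    exact h
  have hu : IsUnit (H.map f).det := by
    have h := (isUnit_iff_ne_zero.mpr hdet).map f
    rw [RingHom.map_det] at h
    exact h
  have hone : adeleConj L (g : Matrix n n 𝔸L).det * (g : Matrix n n 𝔸L).det = 1 := by
    refine hu.mul_left_inj.mp ?_
    calc adeleConj L (g : Matrix n n 𝔸L).det * (g : Matrix n n 𝔸L).det * (H.map f).det
        = adeleConj L (g : Matrix n n 𝔸L).det * (H.map f).det * (g : Matrix n n 𝔸L).det := by ring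
      _ = (H.map f).det := hdetA
      _ = 1 * (H.map f).det := (one_mul _).symm
  -- as units, then norms
  set d : (𝔸L)ˣ := Matrix.GeneralLinearGroup.det g with hd
  have hunits : Units.map (adeleConj L : 𝔸L →* 𝔸L) d * d = 1 := by
    apply Units.ext
    rw [Units.val_mul, Units.coe_map, MonoidHom.coe_coe, Units.val_one]
    exact hone
  have hN : IdeleClassGroup.ideleNorm L d * IdeleClassGroup.ideleNorm L d = 1 := by
    have h := congrArg (IdeleClassGroup.ideleNorm L) hunits
    rwa [map_mul, map_one, ideleNorm_unitsMap_adeleConj] at h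
  have hR : ((IdeleClassGroup.ideleNorm L d : ℝ≥0) : ℝ) * (IdeleClassGroup.ideleNorm L d : ℝ) = 1 := by
    exact_mod_cast hN
  rcases mul_self_eq_one_iff.mp hR with h | h
  · exact_mod_cast h
  · exfalso
    have := (IdeleClassGroup.ideleNorm L d).coe_nonneg
    linarith

/-! ## §5 The descent data: `X · g = (c g)ᵀ X g` on `M_n(𝔸_L)` -/

/-- The right action `X · g = (c g)ᵀ · X · g` of `GL_n(𝔸_L)` on `M_n(𝔸_L)`. -/
def conjAct : RightActionData (GL n 𝔸L) (Matrix n n 𝔸L) where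
  act X g := (((g : Matrix n n 𝔸L).map (adeleConj L))ᵀ * X) * (g : Matrix n n 𝔸L)
  act_mul X g h := by
    simp only [Units.val_mul, Matrix.map_mul, Matrix.transpose_mul, Matrix.mul_assoc]
  act_one X := by
    simp only [Units.val_one, Matrix.map_one (adeleConj L) (map_zero _) (map_one _),
      Matrix.transpose_one, Matrix.one_mul, Matrix.mul_one]

/-- (Ported verbatim from the HodgeCMPerL package; no docstring in the source.) -/
theorem conjAct_act (X : Matrix n n 𝔸L) (g : GL n 𝔸L) :
    (conjAct L).act X g = (((g : Matrix n n 𝔸L).map (adeleConj L))ᵀ * X) * (g : Matrix n n 𝔸L) :=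
  rfl

/-- The stabiliser of `H_𝔸` is the adelic unitary group `U(H)(𝔸_{L⁺})`. -/
theorem stabilizer_conjAct (H : Matrix n n L) :
    (conjAct L).stabilizer (H.map (algebraMap L 𝔸L)) = adelicUnitaryGroup L H :=
  Subgroup.ext fun g => by
    rw [RightActionData.mem_stabilizer_iff, mem_adelicUnitaryGroup_iff, conjAct_act]

/-- (Ported verbatim from the HodgeCMPerL package; no docstring in the source.) -/
theorem continuous_conjAct (X : Matrix n n 𝔸L) :
    Continuous fun g : GL n 𝔸L => (conjAct L).act X g := by
  have hval : Continuous fun g : GL n 𝔸L => (g : Matrix n n 𝔸L) := Units.continuous_val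
  simp only [conjAct_act]
  exact ((hval.matrix_map (continuous_adeleConj L)).matrix_transpose.matrix_mul
    continuous_const).matrix_mul hval

/-- The matrices with principal entries `M_n(L) ⊂ M_n(𝔸_L)`. -/
def principalMatrices : Set (Matrix n n 𝔸L) :=
  {X | ∀ i j, X i j ∈ AdeleRing.principalSubgroup (𝓞 L) L}

omit [IsCMField L] [Fintype n] [DecidableEq n] in
/-- `M_n(L)` is closed in `M_n(𝔸_L)` (a discrete subgroup of a Hausdorff group is closed). -/
theorem isClosed_principalMatrices : IsClosed (principalMatrices L (n := n)) := by
  haveI := AdeleRing.discreteTopology_principalSubgroup L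
  have hP : IsClosed (AdeleRing.principalSubgroup (𝓞 L) L : Set 𝔸L) :=
    AddSubgroup.isClosed_of_discrete
  have hD : principalMatrices L (n := n) =
      ⋂ i, ⋂ j, (fun X : Matrix n n 𝔸L => X i j) ⁻¹' (AdeleRing.principalSubgroup (𝓞 L) L : Set 𝔸L) := by
    ext X
    simp only [principalMatrices, Set.mem_setOf_eq, Set.mem_iInter, Set.mem_preimage, SetLike.mem_coe]
  rw [hD]
  exact isClosed_iInter fun i => isClosed_iInter fun j =>
    hP.preimage (continuous_id.matrix_elem i j)

omit [IsCMField L] [DecidableEq n] in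
/-- `M_n(L)` is discrete in `M_n(𝔸_L)`. -/
theorem discreteTopology_principalMatrices : DiscreteTopology (principalMatrices L (n := n)) := by
  haveI := AdeleRing.discreteTopology_principalSubgroup L
  let e : principalMatrices L (n := n) → Matrix n n (AdeleRing.principalSubgroup (𝓞 L) L) :=
    fun X i j => ⟨X.1 i j, X.2 i j⟩
  have hcont : Continuous e :=
    continuous_pi fun i => continuous_pi fun j =>
      ((continuous_subtype_val.matrix_elem i j).subtype_mk _)
  have hinj : Function.Injective e := by
    intro X Y h
    apply Subtype.ext
    ext i j
    exact congrArg Subtype.val (congrFun (congrFun h i) j)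
  exact DiscreteTopology.of_continuous_injective hcont hinj

omit [IsCMField L] [DecidableEq n] in
/-- `M_n(L)` meets every compact subset of `M_n(𝔸_L)` in a finite set. -/
theorem finite_inter_principalMatrices {C : Set (Matrix n n 𝔸L)} (hC : IsCompact C) :
    (C ∩ principalMatrices L (n := n)).Finite := by
  have hKD : IsCompact (C ∩ principalMatrices L (n := n)) :=
    hC.inter_right (isClosed_principalMatrices L)
  haveI := discreteTopology_principalMatrices L (n := n)
  exact hKD.finite (isDiscrete_iff_discreteTopology.mpr
    (DiscreteTopology.of_subset ‹_› Set.inter_subset_right))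


-- port_pkg: scope closed for this part
end CMField
end HodgeCM.PerL34.Godement
end
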